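import Literature.NumberTheory.GelbartRogawski1991.CompatibleSplitting
import Literature.NumberTheory.Weil1964.AdelicMetaplecticGenerators
import Literature.NumberTheory.Automorphic.UnitaryGroupSymplecticRationalPoints
import Literature.NumberTheory.Automorphic.UnitaryGroupDirectSum
import HarnessLib

-- buildfix G11b-3 recipe (LEDGER B13-1/B13-3): elaborate sequentially so the trailing `attribute [implicit_reducible]`
-- block (reducibilityCoreExt is keyed to the async environment branch) is in force at `.olean` export.
set_option Elab.async false

/-!
# Gelbart–Rogawski 1991, §3.1: the splitting datum OF RECORD for a unitary dual pair, and the pair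
# splitting `U(V)(𝔸) × U(W)(𝔸) →* Mp_ψ(𝕎_𝔸)ᶜᵒⁿᵗ` extracted from Proposition 3.1.1

Topic `NumberTheory/GelbartRogawski1991`; namespace `Literature.NumberTheory.GelbartRogawski1991.UnitaryDualPair`.
KERNEL ONLY: definitions and proved lemmas, **no named facts, no `Prop`-valued definitions, 0 proof holes**; the
cite tags are provenance.  This file CONSTRUCTS the instance of the abstract `SplittingDatum` of
`CompatibleSplitting` (the standing data of [GelbartRogawski1991, §3.1 p. 454]) at which that file's ONE named
fact `SplittingDatum.CompatibleSplitting` (= Prop. 3.1.1, p. 455 L1–3) is meant to be instantiated — its module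
docstring, "intended (and only legitimate) instantiation", object-match notes (a)–(e) — for the dual pair
`U(V) × U(W) ⊆ Sp(Res_{E/F}(V ⊗_E W))` of hermitian spaces over a quadratic extension `E/F` of number fields with
`F`-rational orthogonal Gram matrices `T_V ∈ GL_N(F)`, `T_W ∈ GL_M(F)` (`J_V = T_V ⊗ 1`, `J_W = T_W ⊗ 1`; the
skew-hermitian form is `δ·h`, `δ ∈ E` of trace zero, object-match (c)), out of objects ALREADY CONSTRUCTED in the tree:

* `Sp := symplecticGroup (polar (adelicForm F (Fin n) 𝕋))` — weil-1's coordinate-free `Sp(𝕎_𝔸)`, `𝕎_𝔸 = 𝔸_Fⁿ × 𝔸_Fⁿ`,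
  for the Gram matrix `𝕋 = adelicGram e T_V T_W := reindex e e (T_V ⊗ₖ T_W) ⊗ 1 ∈ GL_n(𝔸_F)` of `Res(V ⊗ W)` along a
  chosen enumeration `e : Fin N × Fin M ≃ Fin n` (`n = N M`; the reindexing is forced because the rational section
  `ratThetaLiftCont` of `AdelicMetaplecticGenerators` is built over `Fin n`, while the dual-pair carriers of
  `UnitaryGroupDualPairCarriers` are indexed by `Fin N × Fin M`);
* `Mp := adelicMpCont F (Fin n) 𝕋` — the LF-continuous implementing pairs `(g, M_g)` of the adelic Schrödinger
  representation (`AdelicMetaplecticContinuous`; object-match (a), (e)), with ITS topology (initial topology of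
  `π` and of the matrix coefficients — coarser than Weil's, object-match (e)); `proj := adelicMpCont.proj` (`π`);
* `GA := UnitaryGroup.adelicPair F E c N M J_V J_W = G₁(𝔸_F)`, `G₁ = U(J_V ⊗ J_W)` (object-match (d): the proposition
  is applied ONCE, to the big unitary group of the dual pair); `toSp := spReindex e ∘ adelicPairToSymplectic`
  (restriction of scalars `E → F`, `UnitaryGroupDualPairCarriers` + `UnitaryGroupDirectSum`);
  `ratPts := (rationalPairToAdelic …).range = G₁(F)`;
* `spRat := (ratSp F 𝕋 _).range = Sp_F(𝕎)` (the rational symplectic group `Sp_{2n}(F) → Sp(𝕎_𝔸)` of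
  `AdelicMetaplecticGenerators`); `toSp_mem_spRat` = "`ι(G₁(F)) ⊆ Sp_F(𝕎)`" from unitary-side
  `adelicPairToSymplectic_rationalPairToAdelic_apply_algebraMap` through `SpTransport.mem_range_transportSp_mapHom`
  (`UnitaryGroupSymplecticRationalPoints`), transported along `e`;
* `ratSplit := ratThetaLiftCont F 𝕋 _ ∘ (ratSp-range ≃ Sp_{2n}(F))` — Weil's `r_F`, the Θ-fixing LF-continuous
  section over the rational points ([Weil1964, n° 40–41]; object-match (b): it IS Gelbart–Rogawski's `i` by
  Θ-rigidity), `proj_ratSplit` = `proj_ratThetaLiftCont`.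

Then, from the cited hypothesis `(hGR : (splittingDatum …).CompatibleSplitting)` — VERBATIM [GelbartRogawski1991,
§3.1 Prop. 3.1.1, p. 455 L1–3]: "*The covering `π` splits over `G(𝐀)`. There exists a continuous section
`s : G(𝐀) → Mp_𝐀(W)` such that `s(G(F))` is contained in `i(Sp_F(W))`.*" — the kernel corollaries of
`CompatibleSplitting` (`IsCompatible.pair`, `pair_mem`, `continuous_pair`) deliver the **pair splitting**
`s_pair : U(J_V)(𝔸_F) × U(J_W)(𝔸_F) →* Mp_ψ(𝕎_𝔸)ᶜᵒⁿᵗ`, `(x, y) ↦ s(x ⊗ 1) s(1 ⊗ y)`: continuous, over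
`ι ∘ (a·b)`, and — because the operators of `r_F` fix the theta functional (`thetaDist_omega_ratThetaLiftCont`,
[Weil1964, n° 41 Thm 6]) — with `ω_ψ(s_pair(γ_U, γ)) ∈ thetaStabilizer` for all RATIONAL `γ_U ∈ U(J_V)(F)`,
`γ ∈ U(J_W)(F)` (`exists_pairSplitting`): exactly the binders `ρ := ω_ψ ∘ s_pair`, `hrat` of
`Weil1964.ThetaKernelDatum.adelicOfDualPair` / `adelicOfDualPairRep` (`ThetaDualPairDatum`).

NOT here: Prop. 3.1.1 itself (a hypothesis, never proved or asserted), the theta majorants of `ω_ψ ∘ s_pair`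
(hypothesis `hρ` of the theta-kernel files — other files), any identification of local components of `s` (the record
pins `s` only up to central twists trivial on `G₁(F)`, `IsCompatible.exists_central_twist`), the CM / `Fin 3 × Fin 2`
specialisation (a consumer instantiates `F := ` the maximal real subfield, `E := ` the CM field, `c := ` complex
conjugation, `e := finProdFinEquiv`).

References: S. Gelbart, J. Rogawski, Invent. Math. 105 (1991) 445–472, §3.1 pp. 454–457 [GelbartRogawski1991];
A. Weil, Acta Math. 111 (1964) 143–211, Chap. III n° 37–41 [Weil1964].
-/

noncomputable section

open scoped Matrix Kronecker
open NumberField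
open Literature.RepresentationTheory.HeisenbergGroup
open Literature.RepresentationTheory.HeisenbergGroup.SymplecticMatrix (transportSp mapHom transportSp_injective)
open Literature.NumberTheory.Automorphic
open Literature.NumberTheory.Weil1964

namespace Literature.NumberTheory.GelbartRogawski1991

namespace UnitaryDualPair

/-! ## §1. The Gram matrix of `Res(V ⊗ W)` enumerated by `Fin n`, over `F` and over `𝔸_F` -/

section Gram

variable (F : Type) [Field F] [NumberField F] {N M n : ℕ} (e : Fin N × Fin M ≃ Fin n)
variable (TV : Matrix (Fin N) (Fin N) F) (TW : Matrix (Fin M) (Fin M) F)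

/-- `𝕋_F := reindex e e (T_V ⊗ₖ T_W) ∈ M_n(F)`: the Gram matrix of `𝕎 = Res_{E/F}(V ⊗ W)` in the enumeration `e`.
[cite: GelbartRogawski1991, §3.1 p. 454] -/
abbrev gram : Matrix (Fin n) (Fin n) F := Matrix.reindex e e (TV ⊗ₖ TW)

/-- `𝕋 := reindex e e (T_V ⊗ 1 ⊗ₖ T_W ⊗ 1) ∈ M_n(𝔸_F)`: the same Gram matrix read in `𝔸_F` — LITERALLY the reindexing
of the Gram matrix `T_V.map ι ⊗ₖ T_W.map ι` of the dual-pair carriers (`adelicPairToSymplectic`), so that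
`spReindex e` lands in `Sp(polar (adelicForm F (Fin n) 𝕋))` by `rfl`. [cite: GelbartRogawski1991, §3.1 p. 454] -/
abbrev adelicGram : Matrix (Fin n) (Fin n) (AdeleRing (𝓞 F) F) :=
  Matrix.reindex e e (TV.map (algebraMap F (AdeleRing (𝓞 F) F)) ⊗ₖ TW.map (algebraMap F (AdeleRing (𝓞 F) F)))

/-- `𝕋 = 𝕋_F ⊗ 1` (entrywise `algebraMap`). [folklore] -/
theorem adelicGram_eq_map : adelicGram F e TV TW = (gram F e TV TW).map (algebraMap F (AdeleRing (𝓞 F) F)) := by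
  rw [adelicGram, UnitaryGroup.kronecker_map_map]
  rfl

variable {TV TW}

omit [NumberField F] in
/-- `det 𝕋_F` is a unit when `det T_V`, `det T_W` are. [folklore] -/
theorem isUnit_det_gram (hVd : IsUnit TV.det) (hWd : IsUnit TW.det) : IsUnit (gram F e TV TW).det := by
  rw [gram, Matrix.det_reindex_self]
  exact UnitaryGroup.SpTransport.isUnit_det_kronecker hVd hWd

/-- `det 𝕋` is a unit when `det T_V`, `det T_W` are. [folklore] -/
theorem isUnit_det_adelicGram (hVd : IsUnit TV.det) (hWd : IsUnit TW.det) : IsUnit (adelicGram F e TV TW).det := by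
  rw [adelicGram_eq_map, ← RingHom.mapMatrix_apply, ← RingHom.map_det]
  exact (isUnit_det_gram F e hVd hWd).map _

/-- The rational symplectic group `ratSp : Sp_{2n}(F) →* Sp(𝕎_𝔸)` is injective (`transportSp` is, and change of
scalars along the injective `F → 𝔸_F` is). [folklore] -/
theorem ratSp_injective (T : Matrix (Fin n) (Fin n) (AdeleRing (𝓞 F) F)) (hT : IsUnit T.det) :
    Function.Injective (ratSp F T hT) := by
  intro A B h
  have h' := transportSp_injective T hT h
  apply Subtype.ext
  exact Matrix.map_injective (AdeleRing.algebraMap_injective (𝓞 F) F) (congrArg Subtype.val h')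

/-- **Weil's section over the rational points, on the subgroup `Sp_F(𝕎) = ratSp(Sp_{2n}(F)) ≤ Sp(𝕎_𝔸)`**:
`i := r_F ∘ (ratSp-range ≃ Sp_{2n}(F))`, `r_F = ratThetaLiftCont` the Θ-fixing LF-continuous lift of
`AdelicMetaplecticGenerators`. [cite: Weil1964, Chap. III n° 40 p. 190, n° 41 Thm 6 p. 193; GelbartRogawski1991, §3.1 p. 454 L40–42] -/
def ratSection (T : Matrix (Fin n) (Fin n) (AdeleRing (𝓞 F) F)) (hT : IsUnit T.det) :
    (ratSp F T hT).range →* adelicMpCont F (Fin n) T :=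
  (ratThetaLiftCont F T hT).comp (MonoidHom.ofInjective (ratSp_injective F T hT)).symm.toMonoidHom

/-- `i (ratSp A) = r_F(A)`. [cite: Weil1964, Chap. III n° 40 p. 190] -/
theorem ratSection_apply (T : Matrix (Fin n) (Fin n) (AdeleRing (𝓞 F) F)) (hT : IsUnit T.det)
    (A : Matrix.symplecticGroup (Fin n) F) :
    ratSection F T hT ⟨ratSp F T hT A, A, rfl⟩ = ratThetaLiftCont F T hT A := by
  show ratThetaLiftCont F T hT ((MonoidHom.ofInjective (ratSp_injective F T hT)).symm _) = _
  congr 1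
  apply (MonoidHom.ofInjective (ratSp_injective F T hT)).injective
  rw [MulEquiv.apply_symm_apply]
  rfl

/-- **`π ∘ i = ` the inclusion `Sp_F(𝕎) ≤ Sp(𝕎_𝔸)`** (`proj_ratThetaLiftCont`). [cite: Weil1964, Chap. III n° 40 p. 190] -/
theorem proj_ratSection (T : Matrix (Fin n) (Fin n) (AdeleRing (𝓞 F) F)) (hT : IsUnit T.det)
    (x : (ratSp F T hT).range) :
    adelicMpCont.proj F (Fin n) T (ratSection F T hT x) = (x : symplecticGroup (polar (adelicForm F (Fin n) T))) :=
  (proj_ratThetaLiftCont F T hT ((MonoidHom.ofInjective (ratSp_injective F T hT)).symm x)).trans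
    (MonoidHom.apply_ofInjective_symm (ratSp_injective F T hT) x)

/-- **The operators of `i` fix `Θ`**: `ω_ψ(i x) ∈ thetaStabilizer` for every `x ∈ Sp_F(𝕎)` ([Weil1964] Thm 6 for
`r_F`, `thetaDist_omega_ratThetaLiftCont`). [cite: Weil1964, Chap. III n° 41 Thm 6 p. 193] -/
theorem omega_ratSection_mem_thetaStabilizer (T : Matrix (Fin n) (Fin n) (AdeleRing (𝓞 F) F)) (hT : IsUnit T.det)
    (x : (ratSp F T hT).range) :
    (adelicMpCont.omega F (Fin n) T).toHomUnits (ratSection F T hT x) ∈ thetaStabilizer F (Fin n) :=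
  (mem_thetaStabilizer_iff _).2 fun Φ =>
    thetaDist_omega_ratThetaLiftCont F T hT ((MonoidHom.ofInjective (ratSp_injective F T hT)).symm x) Φ

end Gram

/-! ## §2. The splitting datum of record for the dual pair `U(J_V) × U(J_W)` -/

section Datum

variable (F E : Type) [Field F] [NumberField F] [Field E] [NumberField E] [Algebra F E]
variable (c : E ≃ₐ[F] E) (N M : ℕ) {n : ℕ} (e : Fin N × Fin M ≃ Fin n)
variable (JV : Matrix (Fin N) (Fin N) E) (JW : Matrix (Fin M) (Fin M) E)

/-- **`ι : G₁(𝔸_F) → Sp(𝕎_𝔸)`**, restriction of scalars `E → F` on the adelic points of `G₁ = U(J_V ⊗ J_W)`, in the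
enumeration `e` (`spReindex e ∘ adelicPairToSymplectic`). [cite: GelbartRogawski1991, §3.1 p. 454] -/
def toSp [Algebra.IsQuadraticExtension F E] {δ : E} (hcδ : c δ = -δ) (hδ : δ ≠ 0) {d : F}
    (hd : δ * δ = algebraMap F E d) {TV : Matrix (Fin N) (Fin N) F} {TW : Matrix (Fin M) (Fin M) F}
    (hV : TV.IsSymm) (hW : TW.IsSymm) (hJV : JV = TV.map (algebraMap F E)) (hJW : JW = TW.map (algebraMap F E)) :
    UnitaryGroup.adelicPair F E c N M JV JW →* symplecticGroup (polar (adelicForm F (Fin n) (adelicGram F e TV TW))) :=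
  (UnitaryGroup.spReindex e _).comp (UnitaryGroup.adelicPairToSymplectic F E c N M hcδ hδ hd hV hW hJV hJW)

/-- formula: `toSp g = e ∘ adelicPairToSymplectic g ∘ e⁻¹`. [folklore] -/
theorem toSp_apply [Algebra.IsQuadraticExtension F E] {δ : E} (hcδ : c δ = -δ) (hδ : δ ≠ 0) {d : F}
    (hd : δ * δ = algebraMap F E d) {TV : Matrix (Fin N) (Fin N) F} {TW : Matrix (Fin M) (Fin M) F}
    (hV : TV.IsSymm) (hW : TW.IsSymm) (hJV : JV = TV.map (algebraMap F E)) (hJW : JW = TW.map (algebraMap F E))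
    (g : UnitaryGroup.adelicPair F E c N M JV JW) :
    toSp F E c N M e JV JW hcδ hδ hd hV hW hJV hJW g =
      UnitaryGroup.spReindex e _ (UnitaryGroup.adelicPairToSymplectic F E c N M hcδ hδ hd hV hW hJV hJW g) :=
  rfl

/-- **`ι(G₁(F)) ⊆ Sp_F(𝕎)`**: for `γ ∈ G₁(F)`, `toSp (γ ⊗ 1)` lies in the range of the rational symplectic group
`ratSp F 𝕋 = transportSp 𝕋 ∘ mapHom (F → 𝔸_F)` — `toSp(γ)` extends the `F`-rational symplectic automorphism
`e ∘ rationalPairToSymplectic γ ∘ e⁻¹` on rational vectors, hence is its base change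
(`SpTransport.mem_range_transportSp_mapHom`). [cite: GelbartRogawski1991, §3.1 p. 455] -/
theorem toSp_rationalPairToAdelic_mem_range [Algebra.IsQuadraticExtension F E] {δ : E} (hcδ : c δ = -δ)
    (hδ : δ ≠ 0) {d : F} (hd : δ * δ = algebraMap F E d) {TV : Matrix (Fin N) (Fin N) F}
    {TW : Matrix (Fin M) (Fin M) F} (hV : TV.IsSymm) (hW : TW.IsSymm) (hVd : IsUnit TV.det) (hWd : IsUnit TW.det)
    (hJV : JV = TV.map (algebraMap F E)) (hJW : JW = TW.map (algebraMap F E))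
    (γ : UnitaryGroup.rationalPair F E c N M JV JW) :
    toSp F E c N M e JV JW hcδ hδ hd hV hW hJV hJW (UnitaryGroup.rationalPairToAdelic F E c N M JV JW γ) ∈
      (ratSp F (adelicGram F e TV TW) (isUnit_det_adelicGram F e hVd hWd)).range := by
  refine UnitaryGroup.SpTransport.mem_range_transportSp_mapHom (gram F e TV TW) (isUnit_det_gram F e hVd hWd)
    (algebraMap F (AdeleRing (𝓞 F) F)) (adelicGram F e TV TW) (isUnit_det_adelicGram F e hVd hWd)
    (adelicGram_eq_map F e TV TW)
    (UnitaryGroup.spReindex e _ (UnitaryGroup.rationalPairToSymplectic F E c N M JV JW hcδ hδ hd hV hW hJV hJW γ))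
    _ fun v => ?_
  have h := UnitaryGroup.adelicPairToSymplectic_rationalPairToAdelic_apply_algebraMap F E c N M JV JW hcδ hδ hd
    hV hW hJV hJW γ (v.1 ∘ e, v.2 ∘ e)
  rw [toSp_apply, UnitaryGroup.coe_spReindex_apply, UnitaryGroup.coe_spReindex_apply,
    UnitaryGroup.reindexW_symm_apply, UnitaryGroup.reindexW_symm_apply, UnitaryGroup.reindexW_apply,
    UnitaryGroup.reindexW_apply]
  change UnitaryGroup.reindexW (AdeleRing (𝓞 F) F) e
      ((UnitaryGroup.adelicPairToSymplectic F E c N M hcδ hδ hd hV hW hJV hJW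
          (UnitaryGroup.rationalPairToAdelic F E c N M JV JW γ)).1
        (⇑(algebraMap F (AdeleRing (𝓞 F) F)) ∘ (v.1 ∘ e), ⇑(algebraMap F (AdeleRing (𝓞 F) F)) ∘ (v.2 ∘ e))) = _
  rw [h]
  rfl

/-- `ι(γ) ∈ Sp_F(𝕎)` for `γ ∈ G₁(F) = (rationalPairToAdelic …).range` — the field `toSp_mem_spRat`. [folklore] -/
theorem toSp_mem_range_ratSp [Algebra.IsQuadraticExtension F E] {δ : E} (hcδ : c δ = -δ)
    (hδ : δ ≠ 0) {d : F} (hd : δ * δ = algebraMap F E d) {TV : Matrix (Fin N) (Fin N) F}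
    {TW : Matrix (Fin M) (Fin M) F} (hV : TV.IsSymm) (hW : TW.IsSymm) (hVd : IsUnit TV.det) (hWd : IsUnit TW.det)
    (hJV : JV = TV.map (algebraMap F E)) (hJW : JW = TW.map (algebraMap F E))
    (γ : UnitaryGroup.adelicPair F E c N M JV JW) (hγ : γ ∈ (UnitaryGroup.rationalPairToAdelic F E c N M JV JW).range) :
    toSp F E c N M e JV JW hcδ hδ hd hV hW hJV hJW γ ∈
      (ratSp F (adelicGram F e TV TW) (isUnit_det_adelicGram F e hVd hWd)).range := by
  obtain ⟨γ₀, rfl⟩ := hγ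
  exact toSp_rationalPairToAdelic_mem_range F E c N M e JV JW hcδ hδ hd hV hW hVd hWd hJV hJW γ₀

/-- **The splitting datum of [GelbartRogawski1991, §3.1 p. 454] for the unitary dual pair `U(J_V) × U(J_W)`**, all
fields CONSTRUCTED: `Sp(𝕎_𝔸)`, `Mp_ψ(𝕎_𝔸)ᶜᵒⁿᵗ` with `π`, `G₁(𝔸_F) = U(J_V ⊗ J_W)(𝔸_F)` with `ι`, `G₁(F)`, `Sp_F(𝕎)`,
`ι(G₁(F)) ⊆ Sp_F(𝕎)`, and Weil's Θ-fixing section `i = r_F : Sp_F(𝕎) → Mp_ψ(𝕎_𝔸)ᶜᵒⁿᵗ` over `π` (module docstring;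
object-match (a)–(e) of `CompatibleSplitting`). [cite: GelbartRogawski1991, §3.1 p. 454 L21–48] -/
def splittingDatum [Algebra.IsQuadraticExtension F E] {δ : E} (hcδ : c δ = -δ) (hδ : δ ≠ 0) {d : F}
    (hd : δ * δ = algebraMap F E d) {TV : Matrix (Fin N) (Fin N) F} {TW : Matrix (Fin M) (Fin M) F}
    (hV : TV.IsSymm) (hW : TW.IsSymm) (hVd : IsUnit TV.det) (hWd : IsUnit TW.det)
    (hJV : JV = TV.map (algebraMap F E)) (hJW : JW = TW.map (algebraMap F E)) :
    SplittingDatum (symplecticGroup (polar (adelicForm F (Fin n) (adelicGram F e TV TW))))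
      (adelicMpCont F (Fin n) (adelicGram F e TV TW)) (UnitaryGroup.adelicPair F E c N M JV JW) where
  proj := adelicMpCont.proj F (Fin n) (adelicGram F e TV TW)
  toSp := toSp F E c N M e JV JW hcδ hδ hd hV hW hJV hJW
  ratPts := (UnitaryGroup.rationalPairToAdelic F E c N M JV JW).range
  spRat := (ratSp F (adelicGram F e TV TW) (isUnit_det_adelicGram F e hVd hWd)).range
  toSp_mem_spRat := toSp_mem_range_ratSp F E c N M e JV JW hcδ hδ hd hV hW hVd hWd hJV hJW
  ratSplit := ratSection F (adelicGram F e TV TW) (isUnit_det_adelicGram F e hVd hWd)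
  proj_ratSplit := proj_ratSection F (adelicGram F e TV TW) (isUnit_det_adelicGram F e hVd hWd)

section Fields

variable [Algebra.IsQuadraticExtension F E] {δ : E} (hcδ : c δ = -δ) (hδ : δ ≠ 0) {d : F}
  (hd : δ * δ = algebraMap F E d) {TV : Matrix (Fin N) (Fin N) F} {TW : Matrix (Fin M) (Fin M) F}
  (hV : TV.IsSymm) (hW : TW.IsSymm) (hVd : IsUnit TV.det) (hWd : IsUnit TW.det)
  (hJV : JV = TV.map (algebraMap F E)) (hJW : JW = TW.map (algebraMap F E))

/-- `proj = π` on `Mp_ψ(𝕎_𝔸)ᶜᵒⁿᵗ`. [folklore] -/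
@[simp] theorem splittingDatum_proj :
    (splittingDatum F E c N M e JV JW hcδ hδ hd hV hW hVd hWd hJV hJW).proj =
      adelicMpCont.proj F (Fin n) (adelicGram F e TV TW) := rfl

/-- `toSp = ι`. [folklore] -/
@[simp] theorem splittingDatum_toSp :
    (splittingDatum F E c N M e JV JW hcδ hδ hd hV hW hVd hWd hJV hJW).toSp =
      toSp F E c N M e JV JW hcδ hδ hd hV hW hJV hJW := rfl

/-- `ratPts = G₁(F)`. [folklore] -/
@[simp] theorem splittingDatum_ratPts :
    (splittingDatum F E c N M e JV JW hcδ hδ hd hV hW hVd hWd hJV hJW).ratPts =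
      (UnitaryGroup.rationalPairToAdelic F E c N M JV JW).range := rfl

/-- `spRat = Sp_F(𝕎)`. [folklore] -/
@[simp] theorem splittingDatum_spRat :
    (splittingDatum F E c N M e JV JW hcδ hδ hd hV hW hVd hWd hJV hJW).spRat =
      (ratSp F (adelicGram F e TV TW) (isUnit_det_adelicGram F e hVd hWd)).range := rfl

/-- `ratSplit = i` (`ratSection`). [folklore] -/
@[simp] theorem splittingDatum_ratSplit :
    (splittingDatum F E c N M e JV JW hcδ hδ hd hV hW hVd hWd hJV hJW).ratSplit =
      ratSection F (adelicGram F e TV TW) (isUnit_det_adelicGram F e hVd hWd) := rfl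

/-- the operators of the datum's `i` fix `Θ` (field form of `omega_ratSection_mem_thetaStabilizer`).
[cite: Weil1964, Chap. III n° 41 Thm 6 p. 193] -/
theorem omega_ratSplit_mem_thetaStabilizer
    (x : (splittingDatum F E c N M e JV JW hcδ hδ hd hV hW hVd hWd hJV hJW).spRat) :
    (adelicMpCont.omega F (Fin n) (adelicGram F e TV TW)).toHomUnits
        ((splittingDatum F E c N M e JV JW hcδ hδ hd hV hW hVd hWd hJV hJW).ratSplit x) ∈
      thetaStabilizer F (Fin n) :=
  omega_ratSection_mem_thetaStabilizer F (adelicGram F e TV TW) (isUnit_det_adelicGram F e hVd hWd) x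

end Fields

end Datum

/-! ## §3. Proposition 3.1.1 ⇒ the pair splitting with `Θ`-stable rational values -/

section Pair

variable (F E : Type) [Field F] [NumberField F] [Field E] [NumberField E] [Algebra F E]
variable (c : E ≃ₐ[F] E) (N M : ℕ) {n : ℕ} (e : Fin N × Fin M ≃ Fin n)
variable (JV : Matrix (Fin N) (Fin N) E) (JW : Matrix (Fin M) (Fin M) E)
variable {TV : Matrix (Fin N) (Fin N) F} {TW : Matrix (Fin M) (Fin M) F}

/-- **The pair splitting of a compatible splitting**: `s_pair (x, y) := s(x ⊗ 1) · s(1 ⊗ y)` on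
`U(J_V)(𝔸_F) × U(J_W)(𝔸_F)` (`MonoidHom.noncommCoprod` along the commuting embeddings `adelicInl`, `adelicInr`;
the concrete form of `SplittingDatum.IsCompatible.pair` of `CompatibleSplitting`). [folklore] -/
def pairSplitting (s : UnitaryGroup.adelicPair F E c N M JV JW →* adelicMpCont F (Fin n) (adelicGram F e TV TW)) :
    UnitaryGroup.adelic F E c N JV × UnitaryGroup.adelic F E c M JW →* adelicMpCont F (Fin n) (adelicGram F e TV TW) :=
  s.comp (MonoidHom.noncommCoprod (UnitaryGroup.adelicInl F E c N M JV JW) (UnitaryGroup.adelicInr F E c N M JV JW)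
    (UnitaryGroup.commute_adelicInl_adelicInr F E c N M JV JW))

/-- formula. [folklore] -/
theorem pairSplitting_apply (s : UnitaryGroup.adelicPair F E c N M JV JW →* adelicMpCont F (Fin n) (adelicGram F e TV TW))
    (p : UnitaryGroup.adelic F E c N JV × UnitaryGroup.adelic F E c M JW) :
    pairSplitting F E c N M e JV JW s p =
      s (UnitaryGroup.adelicInl F E c N M JV JW p.1 * UnitaryGroup.adelicInr F E c N M JV JW p.2) :=
  rfl

/-- The stabiliser conclusion, unfolded: `Θ(ω_ψ(s_pair(γ_U, γ)) Φ) = Θ(Φ)` for all `Φ ∈ 𝒮(𝕎_𝔸)`. [folklore] -/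
theorem thetaDistLM_omega_pairSplitting
    {s : UnitaryGroup.adelicPair F E c N M JV JW →* adelicMpCont F (Fin n) (adelicGram F e TV TW)}
    {γU : UnitaryGroup.adelic F E c N JV} {γ : UnitaryGroup.adelic F E c M JW}
    (h : ((adelicMpCont.omega F (Fin n) (adelicGram F e TV TW)).comp (pairSplitting F E c N M e JV JW s)).toHomUnits
        (γU, γ) ∈ thetaStabilizer F (Fin n)) (Φ : piSchwartzBruhat F (Fin n)) :
    thetaDistLM F (Fin n) (adelicMpCont.omega F (Fin n) (adelicGram F e TV TW) (pairSplitting F E c N M e JV JW s (γU, γ)) Φ) =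
      thetaDistLM F (Fin n) Φ :=
  (mem_thetaStabilizer_iff _).1 h Φ

variable [Algebra.IsQuadraticExtension F E] {δ : E} (hcδ : c δ = -δ) (hδ : δ ≠ 0) {d : F}
  (hd : δ * δ = algebraMap F E d) (hV : TV.IsSymm) (hW : TW.IsSymm) (hVd : IsUnit TV.det) (hWd : IsUnit TW.det)
  (hJV : JV = TV.map (algebraMap F E)) (hJW : JW = TW.map (algebraMap F E))

/-- **[GelbartRogawski1991, Prop. 3.1.1] ⇒ the binders of the adelic theta kernel of the dual pair.**  From the
cited hypothesis `hGR` (Prop. 3.1.1 for `G₁ = U(J_V ⊗ J_W)`, at the datum of record): a compatible splitting `s`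
whose pair splitting `s_pair : U(J_V)(𝔸_F) × U(J_W)(𝔸_F) →* Mp_ψ(𝕎_𝔸)ᶜᵒⁿᵗ` is CONTINUOUS, lies over `ι`
(`π(s_pair(x, y)) = ι(x ⊗ y)`), and has `ω_ψ(s_pair(γ_U, γ)) ∈ thetaStabilizer` for all rational `γ_U ∈ U(J_V)(F)`,
`γ ∈ U(J_W)(F)` (the operators of `i = r_F` fix `Θ`) — the inputs `ρ := ω_ψ ∘ s_pair`, `hrat` of
`Weil1964.ThetaKernelDatum.adelicOfDualPair`. [cite: GelbartRogawski1991, §3.1 Prop. 3.1.1 p. 455 L1–3; Weil1964,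
Chap. III n° 41 Thm 6 p. 193] -/
theorem exists_pairSplitting
    (hGR : (splittingDatum F E c N M e JV JW hcδ hδ hd hV hW hVd hWd hJV hJW).CompatibleSplitting) :
    ∃ s : UnitaryGroup.adelicPair F E c N M JV JW →* adelicMpCont F (Fin n) (adelicGram F e TV TW),
      (splittingDatum F E c N M e JV JW hcδ hδ hd hV hW hVd hWd hJV hJW).IsCompatible s ∧
      Continuous (pairSplitting F E c N M e JV JW s) ∧
      (∀ p : UnitaryGroup.adelic F E c N JV × UnitaryGroup.adelic F E c M JW,
        adelicMpCont.proj F (Fin n) (adelicGram F e TV TW) (pairSplitting F E c N M e JV JW s p) =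
          toSp F E c N M e JV JW hcδ hδ hd hV hW hJV hJW
            (UnitaryGroup.adelicInl F E c N M JV JW p.1 * UnitaryGroup.adelicInr F E c N M JV JW p.2)) ∧
      ∀ γU ∈ (UnitaryGroup.toAdelic F E c N JV).range, ∀ γ ∈ (UnitaryGroup.toAdelic F E c M JW).range,
        ((adelicMpCont.omega F (Fin n) (adelicGram F e TV TW)).comp (pairSplitting F E c N M e JV JW s)).toHomUnits
            (γU, γ) ∈ thetaStabilizer F (Fin n) := by
  obtain ⟨s, hsc, hs⟩ := hGR
  have ha : ∀ γ ∈ (UnitaryGroup.toAdelic F E c N JV).range, UnitaryGroup.adelicInl F E c N M JV JW γ ∈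
      (splittingDatum F E c N M e JV JW hcδ hδ hd hV hW hVd hWd hJV hJW).ratPts := by
    rintro _ ⟨γ, rfl⟩
    exact UnitaryGroup.adelicInl_toAdelic_mem_range F E c N M JV JW γ
  have hb : ∀ γ ∈ (UnitaryGroup.toAdelic F E c M JW).range, UnitaryGroup.adelicInr F E c N M JV JW γ ∈
      (splittingDatum F E c N M e JV JW hcδ hδ hd hV hW hVd hWd hJV hJW).ratPts := by
    rintro _ ⟨γ, rfl⟩
    exact UnitaryGroup.adelicInr_toAdelic_mem_range F E c N M JV JW γ
  refine ⟨s, hs, ?_, ?_, ?_⟩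
  · exact SplittingDatum.continuous_pair hsc (UnitaryGroup.continuous_adelicInl F E c N M JV JW)
      (UnitaryGroup.continuous_adelicInr F E c N M JV JW) _
  · exact (hs.pair _ _ (UnitaryGroup.commute_adelicInl_adelicInr F E c N M JV JW) ha hb).1
  · intro γU hγU γ hγ
    have hmem := hs.pair_mem _ _ (UnitaryGroup.commute_adelicInl_adelicInr F E c N M JV JW) ha hb
      (T := (thetaStabilizer F (Fin n)).toSubmonoid.comap
        (adelicMpCont.omega F (Fin n) (adelicGram F e TV TW)).toHomUnits)
      (fun x => omega_ratSplit_mem_thetaStabilizer F E c N M e JV JW hcδ hδ hd hV hW hVd hWd hJV hJW x) γU hγU γ hγ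
    exact (mem_thetaStabilizer_iff _).2 fun Φ => (mem_thetaStabilizer_iff _).1 hmem Φ

end Pair

/-! ### Build-lane note (ops-buildfix G11b-3 recipe, LEDGER B13-1, 2026-08-21)
`lean -o` (the hub build lane, never `lean`/the gate check) runs Lean 4.32's library-suggestion indexers
(`Lean.LibrarySuggestions.SymbolFrequency` / `SineQuaNon`, from their `exportEntriesFn`) over the statement of
every local theorem that is not a denied premise; on this family's statements (very large dependent binder
telescopes through the theta-kernel / dual-pair data) that fold runs for tens of minutes to hours and the build
lane kills the job (incident G11b-3, run/shared/lean/ops/buildfix/G11b-3-DOSSIER.md). `isDeniedPremise` skips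
`[implicit_reducible]` constants before any fold, and a reducibility status on a *theorem* is inert (Meta never
unfolds `thmInfo`; the kernel ignores the attribute), so the public theorems of this file are tagged
`[implicit_reducible]` purely to keep them out of that index. Only other effect: they are not offered by
`+suggestions` premise selectors. No statement or proof is changed; superseded if the operator lands a
deny-list form (`HarnessLib.PremiseIndex`). -/
set_option allowUnsafeReducibility true in
attribute [implicit_reducible]
  adelicGram_eq_map isUnit_det_gram isUnit_det_adelicGram ratSp_injective ratSection_apply
  proj_ratSection omega_ratSection_mem_thetaStabilizer toSp_apply
  toSp_rationalPairToAdelic_mem_range toSp_mem_range_ratSp splittingDatum_proj splittingDatum_toSp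
  splittingDatum_ratPts splittingDatum_spRat splittingDatum_ratSplit
  omega_ratSplit_mem_thetaStabilizer pairSplitting_apply thetaDistLM_omega_pairSplitting
  exists_pairSplitting

end UnitaryDualPair

end Literature.NumberTheory.GelbartRogawski1991

end
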